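import Mathlib
import HarnessLib
import Summits.HubbardSuperconductivity.HubbardSuperconductivity.Theorems.KLProgrammeAbsUmklappTripleWindows
import Summits.HubbardSuperconductivity.HubbardSuperconductivity.Theorems.KLProgrammeH10TwoPointLimitPerturbedFermiRadius

/-!
# Route `KLProgramme` — K3 engine (stmt-HubbardSuperconductivity-20437), stub (b) (ℓ)/(I2)–(I3), located item «ABS-UMK-COUNT» / «ABS-UMK-34-SIGNPAT»:
# the two conservation windows of a kept triple WITH A MIXED SIGN PATTERN (two legs on the branch of the chart, one on the antipodal branch)

Cell gate-hubbard-kl, seat p4 g16 (mixed-sign twin of `tripleWindows_of_conservation`, p617285).  On a centrally symmetric Fermi curve (`u(θ+π,0) = u(θ,0)`,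
hence `p⃗_F(θ + π) = −p⃗_F(θ)`) a string `k_i = p⃗_F(θ_i) + d_i` with `Σ k_i = R`, two distinguished legs `a, b` at `θ_x = θ⋆ + φ_x + 2πj_x` and a third leg
`c` on the ANTIPODAL branch, `θ_c = θ⋆ + π + φ_c + 2πj_c` (`|φ_x| ≤ Φ`), satisfies — in the chart of part 9 at `θ⋆` (`f(U φ) = V φ`) and with
`Q := R − Σ_{i ∉ {a,b,c}} p⃗_F(θ_i) − p⃗_F(θ⋆)` —

* `fermiPoint_add_pi` — `p⃗_F(θ + π) = −p⃗_F(θ)` (`PerturbedFermiCurve.dir_add_pi`);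
* **`tripleWindowsMixed_of_conservation`** — `|U φ_a + U φ_b − U φ_c − Q·e⃗_t(θ⋆)| ≤ L·δ` and `|f(U φ_a) + f(U φ_b) − f(U φ_c) + Q·e⃗_r(θ⋆)| ≤ L·δ`:
  the windows of the INDEFINITE triple count `ThinLevelSet.card_tripleWindowIndef_le`.

Everything is PROVED; no definitions, no named facts; linear algebra in `ℝ²`. [folklore]
-/

noncomputable section

open Real Set
open Literature.MathematicalPhysics.QuantumLattice Literature.MathematicalPhysics.QuantumLattice.FermiRG
open Literature.MathematicalPhysics.QuantumLattice.FermiRG.BGM2003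

namespace Summit.HubbardSuperconductivity.HubbardSuperconductivity.Theorems.AbsUmklappCount

set_option linter.dupNamespace false -- summit = problem name (single-conjunct summit), D-0017

/-! ## §1 Central symmetry of the Fermi point -/

/-- `p⃗_F(θ + π) = −p⃗_F(θ)` on a centrally symmetric curve (`u(θ+π,0) = u(θ,0)`). [cite: BenfattoGiulianiMastropietro2003, §7.1 (A1.4) p.26 (L24–28)] -/
theorem fermiPoint_add_pi {u : ℝ → ℝ → ℝ} (hanti : ∀ θ : ℝ, u (θ + π) 0 = u θ 0) (θ : ℝ) :
    fermiPoint u (θ + π) = -fermiPoint u θ := by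
  simp only [fermiPoint, levelPoint]
  rw [hanti θ, PerturbedFermiCurve.dir_add_pi, smul_neg]

/-! ## §2 The two windows, mixed signs -/

/-- **The two conservation windows of a kept triple with the sign pattern `(+, +, −)`.**  See the module docstring. [folklore] -/
theorem tripleWindowsMixed_of_conservation {u : ℝ → ℝ → ℝ} (hper : Function.Periodic (fun θ => u θ 0) (2 * π))
    (hanti : ∀ θ : ℝ, u (θ + π) 0 = u θ 0)
    {L : ℕ} (θ : Fin L → ℝ) (k d : Fin L → (Fin 2 → ℝ)) (R : Fin 2 → ℝ)
    (hk : ∀ i, k i = fermiPoint u (θ i) + d i) (hsum : ∑ i, k i = R)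
    (θs : ℝ) {δ : ℝ} (hdt : ∀ i, |d i ⬝ᵥ tdir θs| ≤ δ) (hdn : ∀ i, |d i ⬝ᵥ dir θs| ≤ δ)
    {a b c : Fin L} (hab : a ≠ b) (hac : a ≠ c) (hbc : b ≠ c)
    (φ : Fin L → ℝ) (j : Fin L → ℤ) (hθa : θ a = θs + φ a + j a * (2 * π)) (hθb : θ b = θs + φ b + j b * (2 * π))
    (hθc : θ c = θs + π + φ c + j c * (2 * π))
    {f : ℝ → ℝ} {Φ : ℝ}
    (hval : ∀ ψ ∈ Icc (-Φ) Φ,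
      f ((fermiPoint u (θs + ψ) - fermiPoint u θs) ⬝ᵥ tdir θs) = -((fermiPoint u (θs + ψ) - fermiPoint u θs) ⬝ᵥ dir θs))
    (hφ : ∀ x ∈ ({a, b, c} : Finset (Fin L)), φ x ∈ Icc (-Φ) Φ) :
    |(fermiPoint u (θs + φ a) - fermiPoint u θs) ⬝ᵥ tdir θs + (fermiPoint u (θs + φ b) - fermiPoint u θs) ⬝ᵥ tdir θs -
        (fermiPoint u (θs + φ c) - fermiPoint u θs) ⬝ᵥ tdir θs -
        (R - ∑ i ∈ Finset.univ \ {a, b, c}, fermiPoint u (θ i) - fermiPoint u θs) ⬝ᵥ tdir θs| ≤ L * δ ∧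
      |f ((fermiPoint u (θs + φ a) - fermiPoint u θs) ⬝ᵥ tdir θs) + f ((fermiPoint u (θs + φ b) - fermiPoint u θs) ⬝ᵥ tdir θs) -
        f ((fermiPoint u (θs + φ c) - fermiPoint u θs) ⬝ᵥ tdir θs) +
        (R - ∑ i ∈ Finset.univ \ {a, b, c}, fermiPoint u (θ i) - fermiPoint u θs) ⬝ᵥ dir θs| ≤ L * δ := by
  set T : Finset (Fin L) := {a, b, c} with hT
  set Q := R - ∑ i ∈ Finset.univ \ T, fermiPoint u (θ i) - fermiPoint u θs with hQ
  have ha : a ∈ T := by simp [hT]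
  have hb : b ∈ T := by simp [hT]
  have hc : c ∈ T := by simp [hT]
  -- the kept legs' Fermi points in the chart (leg `c` through the antipode)
  have hfa : fermiPoint u (θ a) = fermiPoint u (θs + φ a) := by rw [hθa, fermiPoint_add_int_mul_two_pi hper]
  have hfb : fermiPoint u (θ b) = fermiPoint u (θs + φ b) := by rw [hθb, fermiPoint_add_int_mul_two_pi hper]
  have hfc : fermiPoint u (θ c) = -fermiPoint u (θs + φ c) := by
    rw [hθc, fermiPoint_add_int_mul_two_pi hper, show θs + π + φ c = (θs + φ c) + π by ring, fermiPoint_add_pi hanti]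
  -- the vector identity `(p_a − p_s) + (p_b − p_s) − (p_c − p_s) = Q − Σ_i d_i`
  have hsplit : ∑ i ∈ Finset.univ \ T, fermiPoint u (θ i) + ∑ x ∈ T, fermiPoint u (θ x) = ∑ i, fermiPoint u (θ i) :=
    Finset.sum_sdiff (Finset.subset_univ T)
  have hall : ∑ i, fermiPoint u (θ i) = R - ∑ i, d i := by
    have : ∑ i, k i = ∑ i, fermiPoint u (θ i) + ∑ i, d i := by
      rw [← Finset.sum_add_distrib]; exact Finset.sum_congr rfl fun i _ => hk i
    rw [hsum] at this
    rw [this]; abel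
  have hTsum : ∑ x ∈ T, fermiPoint u (θ x) = fermiPoint u (θs + φ a) + fermiPoint u (θs + φ b) - fermiPoint u (θs + φ c) := by
    rw [hT, sum_triple hab hac hbc, hfa, hfb, hfc]; abel
  have hvec : (fermiPoint u (θs + φ a) - fermiPoint u θs) + (fermiPoint u (θs + φ b) - fermiPoint u θs) -
      (fermiPoint u (θs + φ c) - fermiPoint u θs) = Q - ∑ i, d i := by
    have h2 : ∑ x ∈ T, fermiPoint u (θ x) = (R - ∑ i, d i) - ∑ i ∈ Finset.univ \ T, fermiPoint u (θ i) := by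
      rw [← hall, ← hsplit]; abel
    rw [hTsum] at h2
    rw [hQ]
    have e : (fermiPoint u (θs + φ a) - fermiPoint u θs) + (fermiPoint u (θs + φ b) - fermiPoint u θs) -
        (fermiPoint u (θs + φ c) - fermiPoint u θs) =
        (fermiPoint u (θs + φ a) + fermiPoint u (θs + φ b) - fermiPoint u (θs + φ c)) - fermiPoint u θs := by abel
    rw [e, h2]; abel
  -- dot products of the error sum
  have herr_t : |(∑ i, d i) ⬝ᵥ tdir θs| ≤ L * δ := by
    rw [sum_dotProduct]
    calc |∑ i, d i ⬝ᵥ tdir θs| ≤ ∑ i, |d i ⬝ᵥ tdir θs| := Finset.abs_sum_le_sum_abs _ _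
      _ ≤ ∑ _i : Fin L, δ := Finset.sum_le_sum fun i _ => hdt i
      _ = L * δ := by rw [Finset.sum_const, nsmul_eq_mul, Finset.card_univ, Fintype.card_fin]
  have herr_n : |(∑ i, d i) ⬝ᵥ dir θs| ≤ L * δ := by
    rw [sum_dotProduct]
    calc |∑ i, d i ⬝ᵥ dir θs| ≤ ∑ i, |d i ⬝ᵥ dir θs| := Finset.abs_sum_le_sum_abs _ _
      _ ≤ ∑ _i : Fin L, δ := Finset.sum_le_sum fun i _ => hdn i
      _ = L * δ := by rw [Finset.sum_const, nsmul_eq_mul, Finset.card_univ, Fintype.card_fin]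
  -- scalar identities
  have htan : (fermiPoint u (θs + φ a) - fermiPoint u θs) ⬝ᵥ tdir θs + (fermiPoint u (θs + φ b) - fermiPoint u θs) ⬝ᵥ tdir θs -
      (fermiPoint u (θs + φ c) - fermiPoint u θs) ⬝ᵥ tdir θs = Q ⬝ᵥ tdir θs - (∑ i, d i) ⬝ᵥ tdir θs := by
    have h := congrArg (fun v => v ⬝ᵥ tdir θs) hvec
    simp only [sub_dotProduct, add_dotProduct] at h ⊢
    linarith [h]
  have hnor : (fermiPoint u (θs + φ a) - fermiPoint u θs) ⬝ᵥ dir θs + (fermiPoint u (θs + φ b) - fermiPoint u θs) ⬝ᵥ dir θs -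
      (fermiPoint u (θs + φ c) - fermiPoint u θs) ⬝ᵥ dir θs = Q ⬝ᵥ dir θs - (∑ i, d i) ⬝ᵥ dir θs := by
    have h := congrArg (fun v => v ⬝ᵥ dir θs) hvec
    simp only [sub_dotProduct, add_dotProduct] at h ⊢
    linarith [h]
  -- the chart identity on the kept legs
  have hva := hval (φ a) (hφ a ha)
  have hvb := hval (φ b) (hφ b hb)
  have hvc := hval (φ c) (hφ c hc)
  constructor
  · rw [htan]
    have e : Q ⬝ᵥ tdir θs - (∑ i, d i) ⬝ᵥ tdir θs - Q ⬝ᵥ tdir θs = -((∑ i, d i) ⬝ᵥ tdir θs) := by ring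
    rw [e, abs_neg]
    exact herr_t
  · rw [hva, hvb, hvc]
    have e : -((fermiPoint u (θs + φ a) - fermiPoint u θs) ⬝ᵥ dir θs) + -((fermiPoint u (θs + φ b) - fermiPoint u θs) ⬝ᵥ dir θs) -
        -((fermiPoint u (θs + φ c) - fermiPoint u θs) ⬝ᵥ dir θs) + Q ⬝ᵥ dir θs =
        -(((fermiPoint u (θs + φ a) - fermiPoint u θs) ⬝ᵥ dir θs + (fermiPoint u (θs + φ b) - fermiPoint u θs) ⬝ᵥ dir θs -
          (fermiPoint u (θs + φ c) - fermiPoint u θs) ⬝ᵥ dir θs) - Q ⬝ᵥ dir θs) := by ring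
    rw [e, abs_neg, hnor]
    have e2 : Q ⬝ᵥ dir θs - (∑ i, d i) ⬝ᵥ dir θs - Q ⬝ᵥ dir θs = -((∑ i, d i) ⬝ᵥ dir θs) := by ring
    rw [e2, abs_neg]
    exact herr_n

end Summit.HubbardSuperconductivity.HubbardSuperconductivity.Theorems.AbsUmklappCount

end
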